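import Literature.NumberTheory.LFunctions.VanDerCorputZeta
import Literature.NumberTheory.LFunctions.TaoLogElliottTheorem23
import Literature.NumberTheory.LFunctions.TaoLogChowla
import Mathlib.NumberTheory.ArithmeticFunction.Liouville
import Mathlib.MeasureTheory.Integral.IntervalIntegral.Basic
import HarnessLib

/-!
# Matomäki–Radziwiłł–Tao 2015, Theorem 1.3 from Theorem 1.7 and (1.12)

Topic `Literature/NumberTheory/LFunctions`. Everything in this file is PROVED (no named facts).

K. Matomäki, M. Radziwiłł, T. Tao, *An averaged form of Chowla's conjecture* (Algebra & Number
Theory 9 (2015) 2167–2196; arXiv:1503.05121) state the exponential sum estimate for the Liouville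
function as Theorem 1.3 and remark after Theorem 1.7: "By (1.12), Theorem 1.7 implies
Theorem 1.3."  Both inputs are named facts of the tree —
`Literature.NumberTheory.LFunctions.MatomakiRadziwillTao2015_theorem17` (`TaoLogElliottTheorem23`) and
`Literature.NumberTheory.LFunctions.MatomakiRadziwillTao2015_liouvilleDistLowerBound` (`TaoLogChowla`, eq. (1.12)) — and this file
records that sentence as a proof:

* `MatomakiRadziwillTao2015_theorem13` — the statement of Theorem 1.3 as printed (a `Prop`):
  `sup_α ∫_0^X |∑_{x ≤ n ≤ x+H} λ(n) e(αn)| dx ≪ (log log H/log H + log^{-1/700} X) H X` for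
  `10 ≤ H ≤ X`;
* `MatomakiRadziwillTao2015_theorem13_of_theorem17` — its proof from the two facts: with `ε = 1/6`
  in (1.12), `M(λ; X, Q) ≥ (1/6) log log X - C` for `Q = min(log^{1/125} X, log⁵ H) ≥ 1`, so
  `exp(-M/20) ≤ e^{C/20} log^{-1/120} X ≤ e^{C/20} log^{-1/700} X` for `X ≥ X₀`, while for the
  bounded range `10 ≤ H ≤ X < X₀` the trivial bound `(H+1) X` is `≪_{X₀} log^{-1/700} X · H X`.

Theorem 1.3 is the input "[15, Theorem 1.3]" of Proposition 2.4 of Tao 2016 in the Liouville case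
(Tao, Forum Math. Pi 4 (2016) e8, §2 and Remark 3.8).

## References
* K. Matomäki, M. Radziwiłł, T. Tao, Algebra & Number Theory 9 (2015) 2167–2196;
  arXiv:1503.05121: Theorem 1.3, Theorem 1.7, (1.12) and the sentence following Theorem 1.7.

## Design choices
* `e(t) = exp(2πit)` is `Literature.NumberTheory.LFunctions.VdC.e`; the integrand of Theorem 1.7 for `g = λ` is identified with
  ours termwise (`Complex.exp (2π I α n) = e(α n)`).
* `λ(n)` is written `((liouville n : ℤ) : ℂ)`, i.e. `(liouville : ArithmeticFunction ℂ) n`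
  (`ArithmeticFunction.intCoe_apply`), the convention of `TaoLogChowla`.
-/

open Finset Real

noncomputable section

namespace Literature.NumberTheory.LFunctions

namespace Tao2016

/-- **Matomäki–Radziwiłł–Tao 2015, Theorem 1.3 (exponential sum estimate)**, the statement:
"For any `10 ≤ H ≤ X`, one has
`sup_{α ∈ ℝ} ∫_0^X |∑_{x ≤ n ≤ x+H} λ(n) e(αn)| dx ≪ (log log H / log H + 1 / log^{1/700} X) H X`",
with an absolute implied constant (`e(t) = exp(2πit)` is `Literature.NumberTheory.LFunctions.VdC.e`; `λ` is the Liouville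
function, Mathlib's `ArithmeticFunction.liouville`; the sum is over the integers `n` of
`[x, x + H]`, which are positive for `x > 0`). This is the input ("[15, Theorem 1.3]") of
Proposition 2.4 of Tao 2016 in the Liouville case. It is NOT a new named fact: the paper derives it
("By (1.12), Theorem 1.7 implies Theorem 1.3", MRT 2015, §1) from Theorem 1.7 and (1.12), both
vendored in the tree, and `MatomakiRadziwillTao2015_theorem13_of_theorem17` below is that
derivation; downstream users take `(h : MatomakiRadziwillTao2015_theorem13)` and are fed that
theorem. [cite: MatomakiRadziwillTao2015, Theorem 1.3] -/
def MatomakiRadziwillTao2015_theorem13 : Prop :=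
  ∃ C : ℝ, ∀ H X : ℝ, 10 ≤ H → H ≤ X → ∀ α : ℝ,
    ∫ x in (0 : ℝ)..X, ‖∑ n ∈ Finset.Icc ⌈x⌉₊ ⌊x + H⌋₊,
        ((ArithmeticFunction.liouville n : ℤ) : ℂ) * VdC.e (α * n)‖
      ≤ C * (Real.log (Real.log H) / Real.log H + 1 / (Real.log X) ^ (1 / 700 : ℝ)) * H * X

/-- The number of integers in `[x, x + H]` is at most `H + 1` (`x ≥ 0`). [folklore] -/
theorem card_Icc_ceil_floor_le {x H : ℝ} (hx : 0 ≤ x) (hH : 0 ≤ H) :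
    (#(Finset.Icc ⌈x⌉₊ ⌊x + H⌋₊) : ℝ) ≤ H + 1 := by
  rw [Nat.card_Icc]
  have h1 : ⌊x + H⌋₊ < ⌈x⌉₊ + ⌊H⌋₊ + 1 := by
    have h0 : x + H < ((⌈x⌉₊ + ⌊H⌋₊ + 1 : ℕ) : ℝ) := by
      push_cast; linarith [Nat.le_ceil x, Nat.lt_floor_add_one H]
    exact (Nat.floor_lt (by positivity)).2 h0
  have h2 : (⌊x + H⌋₊ + 1 - ⌈x⌉₊ : ℕ) ≤ ⌊H⌋₊ + 1 := by omega
  calc ((⌊x + H⌋₊ + 1 - ⌈x⌉₊ : ℕ) : ℝ) ≤ ((⌊H⌋₊ + 1 : ℕ) : ℝ) := by exact_mod_cast h2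
    _ ≤ H + 1 := by push_cast; linarith [Nat.floor_le hH]

open MeasureTheory in
/-- **MRT 2015: "By (1.12), Theorem 1.7 implies Theorem 1.3."** Theorem 1.3 for `λ` from the tree's
named facts Theorem 1.7 (`Literature.NumberTheory.LFunctions.MatomakiRadziwillTao2015_theorem17`) and (1.12)
(`Literature.NumberTheory.LFunctions.MatomakiRadziwillTao2015_liouvilleDistLowerBound`): with `ε = 1/6`, (1.12) gives
`M(λ; X, Q) ≥ (1/6) log log X - C` for `Q = min(log^{1/125} X, log⁵ H)`, so
`exp(-M/20) ≤ e^{C/20} log^{-1/120} X ≤ e^{C/20} log^{-1/700} X` for `X ≥ X₀`; for the finitely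
bounded range `10 ≤ H ≤ X < X₀` the trivial bound `(H+1) X` is `≪_{X₀} log^{-1/700} X · HX`.
[cite: MatomakiRadziwillTao2015, §1 (sentence after Theorem 1.7: Theorem 1.7 and (1.12) imply Theorem 1.3)] -/
theorem MatomakiRadziwillTao2015_theorem13_of_theorem17 (h17 : MatomakiRadziwillTao2015_theorem17)
    (h112 : MatomakiRadziwillTao2015_liouvilleDistLowerBound) :
    MatomakiRadziwillTao2015_theorem13 := by
  obtain ⟨C₁, hC₁⟩ := h17
  obtain ⟨C₂, X₀, h12⟩ := h112.pretentiousDistSq_ge (1 / 6) (by norm_num)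
  set L : ArithmeticFunction ℂ := (ArithmeticFunction.liouville : ArithmeticFunction ℂ) with hL
  set X₁ : ℝ := max X₀ (Real.exp (Real.exp 1)) with hX₁
  have hX₁e : Real.exp (Real.exp 1) ≤ X₁ := le_max_right _ _
  have hX₁pos : 0 < X₁ := lt_of_lt_of_le (Real.exp_pos _) hX₁e
  have hlogX₁ : 1 ≤ Real.log X₁ := by
    have : Real.exp 1 ≤ Real.log X₁ := by
      rw [← Real.log_exp (Real.exp 1)]; exact Real.log_le_log (Real.exp_pos _) hX₁e
    linarith [Real.add_one_le_exp (1 : ℝ)]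
  set C₁' : ℝ := max C₁ 0 with hC₁'
  set K : ℝ := max (C₁' * (Real.exp (C₂ / 20) + 1)) (2 * Real.log X₁ ^ (1 / 700 : ℝ)) with hK
  refine ⟨K, fun H X hH hHX α => ?_⟩
  have hH0 : (0 : ℝ) < H := by linarith
  have hX0 : (0 : ℝ) < X := by linarith
  have hX10 : (10 : ℝ) ≤ X := hH.trans hHX
  have hlogX : 0 < Real.log X := Real.log_pos (by linarith)
  have hlogH1 : 1 ≤ Real.log H := by
    rw [← Real.log_exp 1]
    exact Real.log_le_log (Real.exp_pos 1) (by have := Real.exp_one_lt_three; linarith)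
  have hrate0 : 0 ≤ Real.log (Real.log H) / Real.log H + 1 / Real.log X ^ (1 / 700 : ℝ) := by
    have : 0 ≤ Real.log (Real.log H) := Real.log_nonneg hlogH1
    positivity
  have hrate1 : 1 / Real.log X ^ (1 / 700 : ℝ)
      ≤ Real.log (Real.log H) / Real.log H + 1 / Real.log X ^ (1 / 700 : ℝ) := by
    have : 0 ≤ Real.log (Real.log H) / Real.log H := div_nonneg (Real.log_nonneg hlogH1) (by linarith)
    linarith
  -- the integrand of Theorem 1.7 for `g = λ` is ours
  have hint : ∀ x : ℝ, (∑ n ∈ Finset.Icc ⌈x⌉₊ ⌊x + H⌋₊,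
      L n * Complex.exp (2 * Real.pi * Complex.I * (α : ℂ) * (n : ℂ)))
      = ∑ n ∈ Finset.Icc ⌈x⌉₊ ⌊x + H⌋₊, ((ArithmeticFunction.liouville n : ℤ) : ℂ) * VdC.e (α * n) := by
    intro x
    refine sum_congr rfl fun n _ => ?_
    rw [hL, ArithmeticFunction.intCoe_apply, VdC.e]
    congr 1
    congr 1
    push_cast
    ring
  rcases le_or_gt X₁ X with hXX₁ | hXX₁
  · -- large `X`: Theorem 1.7 and (1.12)
    have hXX₀ : X₀ ≤ X := le_trans (le_max_left _ _) hXX₁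
    have hlogX1 : 1 ≤ Real.log X := hlogX₁.trans (Real.log_le_log hX₁pos hXX₁)
    have h1 := hC₁ L isMultiplicative_liouville_complex norm_liouville_complex_le_one X H hH hHX α
    simp only [hint] at h1
    -- lower bound for `M(λ; X, Q)`
    set Q : ℝ := min (Real.log X ^ (1 / 125 : ℝ)) (Real.log H ^ (5 : ℝ)) with hQ
    have hQ1 : 1 ≤ Q := by
      rw [hQ, le_min_iff]
      exact ⟨Real.one_le_rpow hlogX1 (by norm_num), Real.one_le_rpow hlogH1 (by norm_num)⟩
    have hQle : Q ≤ Real.log X ^ (1 / 125 : ℝ) := min_le_left _ _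
    have hM : (1 / 3 - 1 / 6) * Real.log (Real.log X) - C₂ ≤ Sieve.nonpretentiousness L X Q := by
      unfold Sieve.nonpretentiousness Sieve.charNonpretentiousness
      haveI : Nonempty (Set.Icc 1 ⌊Q⌋₊) := ⟨⟨1, Set.mem_Icc.2 ⟨le_rfl, Nat.le_floor (by exact_mod_cast hQ1)⟩⟩⟩
      refine le_ciInf fun q => ?_
      haveI : Nonempty (DirichletCharacter ℂ (q : ℕ)) := ⟨1⟩
      refine le_ciInf fun χ => ?_
      haveI : Nonempty (Set.Icc (-X) X) := ⟨⟨0, Set.mem_Icc.2 ⟨by linarith, hX0.le⟩⟩⟩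
      refine le_ciInf fun t => ?_
      have hq := q.2
      rw [Set.mem_Icc] at hq
      refine h12 X hXX₀ q χ t hq.1 ?_ (abs_le.2 (Set.mem_Icc.1 t.2))
      calc ((q : ℕ) : ℝ) ≤ ⌊Q⌋₊ := by exact_mod_cast hq.2
        _ ≤ Q := Nat.floor_le (by linarith)
        _ ≤ Real.log X ^ (1 / 125 : ℝ) := hQle
    have hexp : Real.exp (-(Sieve.nonpretentiousness L X Q) / 20) ≤ Real.exp (C₂ / 20) * (1 / Real.log X ^ (1 / 700 : ℝ)) := by
      have h2 : -(Sieve.nonpretentiousness L X Q) / 20 ≤ C₂ / 20 + (-(1 / 120)) * Real.log (Real.log X) := by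
        linarith
      calc Real.exp (-(Sieve.nonpretentiousness L X Q) / 20)
          ≤ Real.exp (C₂ / 20 + (-(1 / 120)) * Real.log (Real.log X)) := Real.exp_le_exp.2 h2
        _ = Real.exp (C₂ / 20) * Real.log X ^ (-(1 / 120) : ℝ) := by
            rw [Real.exp_add, Real.rpow_def_of_pos hlogX, mul_comm (Real.log (Real.log X))]
        _ ≤ Real.exp (C₂ / 20) * Real.log X ^ (-(1 / 700) : ℝ) := by
            apply mul_le_mul_of_nonneg_left _ (Real.exp_pos _).le
            exact Real.rpow_le_rpow_of_exponent_le hlogX1 (by norm_num)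
        _ = Real.exp (C₂ / 20) * (1 / Real.log X ^ (1 / 700 : ℝ)) := by
            rw [Real.rpow_neg hlogX.le, inv_eq_one_div]
    have hHX0 : 0 ≤ (H : ℝ) * X := by positivity
    set E : ℝ := Real.exp (-(Sieve.nonpretentiousness L X Q) / 20)
      + Real.log (Real.log H) / Real.log H + 1 / Real.log X ^ (1 / 700 : ℝ) with hE
    have hE0 : 0 ≤ E := by
      have := Real.exp_pos (-(Sieve.nonpretentiousness L X Q) / 20); rw [hE]; linarith
    have h1' : ∫ x in (0 : ℝ)..X, ‖∑ n ∈ Finset.Icc ⌈x⌉₊ ⌊x + H⌋₊,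
        ((ArithmeticFunction.liouville n : ℤ) : ℂ) * VdC.e (α * n)‖ ≤ C₁' * E * H * X := by
      refine h1.trans ?_
      have e : ∀ c : ℝ, c * E * H * X = c * (E * (H * X)) := fun c => by ring
      rw [e, e]
      exact mul_le_mul_of_nonneg_right (le_max_left _ _) (mul_nonneg hE0 hHX0)
    calc ∫ x in (0 : ℝ)..X, ‖∑ n ∈ Finset.Icc ⌈x⌉₊ ⌊x + H⌋₊,
          ((ArithmeticFunction.liouville n : ℤ) : ℂ) * VdC.e (α * n)‖
        ≤ C₁' * E * H * X := h1'
      _ ≤ C₁' * ((Real.exp (C₂ / 20) + 1)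
            * (Real.log (Real.log H) / Real.log H + 1 / Real.log X ^ (1 / 700 : ℝ))) * H * X := by
          have hC0 : 0 ≤ C₁' := le_max_right _ _
          apply mul_le_mul_of_nonneg_right _ hX0.le
          apply mul_le_mul_of_nonneg_right _ hH0.le
          apply mul_le_mul_of_nonneg_left _ hC0
          rw [hE]
          have := mul_le_mul_of_nonneg_left hrate1 (Real.exp_pos (C₂ / 20)).le
          nlinarith [hexp, hrate0]
      _ = (C₁' * (Real.exp (C₂ / 20) + 1))
            * (Real.log (Real.log H) / Real.log H + 1 / Real.log X ^ (1 / 700 : ℝ)) * H * X := by ring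
      _ ≤ K * (Real.log (Real.log H) / Real.log H + 1 / Real.log X ^ (1 / 700 : ℝ)) * H * X := by
          apply mul_le_mul_of_nonneg_right _ hX0.le
          apply mul_le_mul_of_nonneg_right _ hH0.le
          exact mul_le_mul_of_nonneg_right (le_max_left _ _) hrate0
  · -- small `X`: trivial bound
    have hbound : ∀ x ∈ Set.uIoc (0 : ℝ) X, ‖(‖∑ n ∈ Finset.Icc ⌈x⌉₊ ⌊x + H⌋₊,
        ((ArithmeticFunction.liouville n : ℤ) : ℂ) * VdC.e (α * n)‖)‖ ≤ H + 1 := by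
      intro x hx
      rw [Set.uIoc_of_le hX0.le] at hx
      rw [norm_norm]
      refine (norm_sum_le _ _).trans ?_
      calc ∑ n ∈ Finset.Icc ⌈x⌉₊ ⌊x + H⌋₊, ‖((ArithmeticFunction.liouville n : ℤ) : ℂ) * VdC.e (α * n)‖
          ≤ ∑ n ∈ Finset.Icc ⌈x⌉₊ ⌊x + H⌋₊, (1 : ℝ) := by
            refine sum_le_sum fun n _ => ?_
            rw [norm_mul, VdC.norm_e, mul_one]
            rw [← ArithmeticFunction.intCoe_apply]; exact norm_liouville_complex_le_one n
        _ = #(Finset.Icc ⌈x⌉₊ ⌊x + H⌋₊) := by simp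
        _ ≤ H + 1 := card_Icc_ceil_floor_le hx.1.le hH0.le
    have h1 := intervalIntegral.norm_integral_le_of_norm_le_const hbound
    rw [Real.norm_eq_abs, sub_zero, abs_of_pos hX0] at h1
    have h2 : ∫ x in (0 : ℝ)..X, ‖∑ n ∈ Finset.Icc ⌈x⌉₊ ⌊x + H⌋₊,
        ((ArithmeticFunction.liouville n : ℤ) : ℂ) * VdC.e (α * n)‖ ≤ (H + 1) * X := (le_abs_self _).trans h1
    -- `(H+1) X ≤ 2 log^{1/700} X₁ · log^{-1/700} X · H X`
    have hlogle : Real.log X ≤ Real.log X₁ := Real.log_le_log hX0 hXX₁.le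
    have hr : 1 ≤ Real.log X₁ ^ (1 / 700 : ℝ) * (1 / Real.log X ^ (1 / 700 : ℝ)) := by
      rw [mul_one_div, le_div_iff₀ (Real.rpow_pos_of_pos hlogX _), one_mul]
      exact Real.rpow_le_rpow hlogX.le hlogle (by norm_num)
    calc ∫ x in (0 : ℝ)..X, ‖∑ n ∈ Finset.Icc ⌈x⌉₊ ⌊x + H⌋₊,
          ((ArithmeticFunction.liouville n : ℤ) : ℂ) * VdC.e (α * n)‖
        ≤ (H + 1) * X := h2
      _ ≤ 2 * H * X := by nlinarith
      _ ≤ 2 * H * X * (Real.log X₁ ^ (1 / 700 : ℝ) * (1 / Real.log X ^ (1 / 700 : ℝ))) :=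
          le_mul_of_one_le_right (by positivity) hr
      _ = (2 * Real.log X₁ ^ (1 / 700 : ℝ)) * (1 / Real.log X ^ (1 / 700 : ℝ)) * H * X := by ring
      _ ≤ K * (Real.log (Real.log H) / Real.log H + 1 / Real.log X ^ (1 / 700 : ℝ)) * H * X := by
          apply mul_le_mul_of_nonneg_right _ hX0.le
          apply mul_le_mul_of_nonneg_right _ hH0.le
          exact mul_le_mul (le_max_right _ _) hrate1 (by positivity) (le_trans (by positivity) (le_max_right _ _))

end Tao2016

end Literature.NumberTheory.LFunctions

end
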